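import Literature.AlgebraicGeometry.Modules.UnitCocyclePresented
import Literature.AlgebraicGeometry.Modules.UnitCocycleDefectArith
import Mathlib.RingTheory.Nilpotent.Basic
import HarnessLib

/-!
# Lifting classes of line bundles along closed subschemes cut out by powers of `p`

The elementary obstruction theory for `Ȟ¹(-, 𝒪^×)` (`Modules/UnitCocycle.lean`) along a
factorisation `ι = t ≫ ι'` of morphisms of schemes `Y ⟶ Y' ⟶ X`, where one should think of
`Y = X_n ↪ Y' = X_{n+1} ↪ X` as two consecutive members of a tower of closed subschemes of `X` cut
out by `pⁿ`, `pⁿ⁺¹` (the hypotheses are exactly what this situation provides: `ι`, `ι'` are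
topological embeddings, surjective on sections over affine opens with kernels `pⁿ Γ`, `pⁿ⁺¹ Γ`,
and `pⁿ = 0` on `Y`, `pⁿ⁺¹ = 0` on `Y'`). Classes are handled through presentation data
`(A, G)` on `X` (`Modules/UnitCocyclePresented.lean`).

* `UnitCocycle.exists_presented_coboundary` — if a class `[g]` on `Y` presented by `(A, G)` is
  `t^*` of a class on `Y'`, then on an affine refinement `A'` the coboundary exhibiting this is
  presented by sections of `X`: lifts `L_{ab}` of a cocycle on `Y'`, `λ_a`, `μ_a` of the coboundary
  and its inverse, with `G_{ab} λ_b ≡ λ_a L_{ab}` under `ι^♯`;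
* `UnitCocycle.exists_coboundary_of_lifts` — (**obstruction ⇒**) hence the defect of `G` satisfies
  `G_{ab} G_{bc} ≡ G_{ac}(1 + pⁿ(v_{bc} - v_{ac} + v_{ab})) (mod pⁿ⁺¹)` on the refinement
  (`Modules/UnitCocycleDefectArith.mul_mul_eq_of_coboundary_rel`);
* `UnitCocycle.exists_lift_of_coboundary` — (**obstruction ⇐**) conversely such a congruence
  makes `[g]` the pull-back of the class on `Y'` presented by `G_{ab}(1 - pⁿ v_{ab})`;
* `UnitCocycle.exists_defect_of_app_eq`, `isUnit_app_of_mul_eq` — reading the cocycle identity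
  under `ι^♯` as a congruence modulo `pⁿ` on affine opens, and units modulo nilpotents.

This is Hartshorne III Ex. 4.6 (`0 → 𝓘 → 𝒪^×_{X'} → 𝒪^×_{X} → 1` for a square-zero `𝓘`, and the
induced `Pic X' → Pic X → H²(𝓘)`) made explicit on Čech cocycles, for the ideal `pⁿ𝒪/pⁿ⁺¹𝒪`.
Everything is proved; no named facts; no definitions.

## References

* R. Hartshorne, *Algebraic Geometry*, GTM 52 (1977), III §4, Ex. III.4.4–4.6. [Hartshorne1977]
-/

noncomputable section

open CategoryTheory AlgebraicGeometry Opposite TopologicalSpace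

namespace Literature.AlgebraicGeometry.Modules

universe u v

variable {X Y Y' : Scheme.{u}} {S : Type v}

/-- `t^♯ ∘ ι'^♯ = (t ≫ ι')^♯` on sections over `U` (on the nose, over `(t ≫ ι')⁻¹ U`). [folklore] -/
theorem appLE_app (t : Y ⟶ Y') (ι' : Y' ⟶ X) (U : X.Opens) (s : Γ(X, U)) :
    t.appLE (ι' ⁻¹ᵁ U) ((t ≫ ι') ⁻¹ᵁ U) le_rfl (ι'.app U s) = (t ≫ ι').app U s := by
  rw [Scheme.Hom.app_eq_appLE ι', appLE_appLE, Scheme.Hom.app_eq_appLE (t ≫ ι')]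

/-- An element of `Γ(X, U)` invertible modulo a natural number `q` which is nilpotent on `Y` maps
to a unit under `ι^♯`. [folklore] -/
theorem isUnit_app_of_mul_eq (ι : Y ⟶ X) {U : X.Opens} {q : ℕ}
    (hq : IsNilpotent (q : Γ(Y, ι ⁻¹ᵁ U))) {a b e : Γ(X, U)} (h : a * b = 1 + (q : Γ(X, U)) * e) :
    IsUnit (ι.app U a) := by
  have h' : IsUnit (ι.app U a * ι.app U b) := by
    rw [← map_mul, h, map_add, map_one, map_mul, map_natCast]
    exact ((Commute.all _ _).isNilpotent_mul_right hq).isUnit_one_add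
  exact isUnit_of_mul_isUnit_left h'

namespace UnitCocycle

/-- **Reading the cocycle identity under `ι^♯` as a congruence.** If `ι^♯` has kernel `pⁿ Γ(X, U)`
on affine opens `U` and the datum `(A, G)` satisfies the cocycle identity under `ι^♯`, then over
every affine `W` below `A_a ⊓ A_b`, `A_b ⊓ A_c`, `A_a ⊓ A_c` one has
`G_{ab} G_{bc} = G_{ac} + pⁿ y` for some `y ∈ Γ(X, W)`. [folklore] -/
theorem exists_defect_of_app_eq (ι : Y ⟶ X) (p n : ℕ)
    (hker : ∀ U : X.Opens, IsAffineOpen U → ∀ r : Γ(X, U), ι.app U r = 0 →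
      ∃ c : Γ(X, U), r = (p : Γ(X, U)) ^ n * c)
    (A : S → X.Opens) (G : ∀ a b : S, Γ(X, A a ⊓ A b))
    (hmul : ∀ (a b c : S) (i₁ : A a ⊓ A b ⊓ A c ≤ A a ⊓ A b) (i₂ : A a ⊓ A b ⊓ A c ≤ A b ⊓ A c)
      (i₃ : A a ⊓ A b ⊓ A c ≤ A a ⊓ A c),
      ι.app _ (secRes X i₁ (G a b) * secRes X i₂ (G b c)) = ι.app _ (secRes X i₃ (G a c)))
    (a b c : S) {W : X.Opens} (hW : IsAffineOpen W) (i₁ : W ≤ A a ⊓ A b) (i₂ : W ≤ A b ⊓ A c)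
    (i₃ : W ≤ A a ⊓ A c) :
    ∃ y : Γ(X, W), secRes X i₁ (G a b) * secRes X i₂ (G b c) =
      secRes X i₃ (G a c) + (p : Γ(X, W)) ^ n * y := by
  have k : W ≤ A a ⊓ A b ⊓ A c := le_inf i₁ (i₂.trans inf_le_right)
  obtain ⟨y, hy⟩ := hker W hW (secRes X i₁ (G a b) * secRes X i₂ (G b c) - secRes X i₃ (G a c))
    (by
      have h := congrArg (secRes Y (ι.preimage_mono k)) (hmul a b c inf_le_left
        (le_inf (inf_le_left.trans inf_le_right) inf_le_right)
        (le_inf (inf_le_left.trans inf_le_left) inf_le_right))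
      rw [← app_secRes ι k, ← app_secRes ι k, map_mul, secRes_secRes, secRes_secRes,
        secRes_secRes] at h
      rw [map_sub, sub_eq_zero]
      exact h)
  exact ⟨y, by linear_combination hy⟩

/-- **Presenting the coboundary of a liftable class.** Let `ι = t ≫ ι'` with `ι`, `ι'` topological
embeddings which are surjective on sections over affine opens, let intersections of affine opens of
`X` be affine, and let `π : Y → S` be a bijection with inverse `σ`. If the class of a cocycle `g` on
`Y` presented by `(A, G)` along `ι` is `t^*[Λ]` for a cocycle `Λ` on `Y'`, then on suitable affine
`A'_a ≤ A_a` (still `ι(σ a) ∈ A'_a`) there are sections `L_{ab} ∈ Γ(X, A'_a ⊓ A'_b)` lifting a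
cocycle on `Y'` (cocycle identity under `ι'^♯`) and `λ_a, μ_a ∈ Γ(X, A'_a)` with `ι^♯(λ_a μ_a) = 1`
and `ι^♯(G_{ab} λ_b) = ι^♯(λ_a L_{ab})` (Hartshorne III §4: unwinding `[g] = t^*[Λ]`). [folklore] -/
theorem exists_presented_coboundary (t : Y ⟶ Y') (ι' : Y' ⟶ X) {ι : Y ⟶ X} (hι : ι = t ≫ ι')
    (hιe : Topology.IsInducing ι.base) (hι'e : Topology.IsInducing ι'.base)
    (hsurj : ∀ U : X.Opens, IsAffineOpen U → Function.Surjective (ι.app U))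
    (hsurj' : ∀ U : X.Opens, IsAffineOpen U → Function.Surjective (ι'.app U))
    (hinf : ∀ U V : X.Opens, IsAffineOpen U → IsAffineOpen V → IsAffineOpen (U ⊓ V))
    (π : Y → S) (σ : S → Y) (hπσ : ∀ a, π (σ a) = a)
    (A : S → X.Opens) (G : ∀ a b : S, Γ(X, A a ⊓ A b)) (mem : ∀ y, ι.base y ∈ A (π y))
    {g : UnitCocycle Y} (hU : ∀ y, g.U y = ι ⁻¹ᵁ A (π y))
    (hg : ∀ (y y' : Y) (V : Y.Opens) (hy : V ≤ g.U y) (hy' : V ≤ g.U y'),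
      g.g y y' V hy hy' = ι.appLE (A (π y) ⊓ A (π y')) V
        (le_preimage_inf ι (hy.trans_eq (hU y)) (hy'.trans_eq (hU y'))) (G (π y) (π y')))
    {Λ : UnitCocycle Y'} (hΛ : CechPic.pullback t (CechPic.mk Λ) = CechPic.mk g) :
    ∃ (A' : S → X.Opens) (_ : ∀ a, IsAffineOpen (A' a)) (_ : ∀ a, A' a ≤ A a)
      (_ : ∀ a, ι.base (σ a) ∈ A' a) (L : ∀ a b : S, Γ(X, A' a ⊓ A' b))
      (Λ₁ Λ₂ : ∀ a : S, Γ(X, A' a)),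
      (∀ (a b c : S) (i₁ : A' a ⊓ A' b ⊓ A' c ≤ A' a ⊓ A' b)
        (i₂ : A' a ⊓ A' b ⊓ A' c ≤ A' b ⊓ A' c) (i₃ : A' a ⊓ A' b ⊓ A' c ≤ A' a ⊓ A' c),
        ι'.app _ (secRes X i₁ (L a b) * secRes X i₂ (L b c)) = ι'.app _ (secRes X i₃ (L a c))) ∧
      (∀ a, ι.app _ (Λ₁ a * Λ₂ a) = 1) ∧
      (∀ (a b : S) (j : A' a ⊓ A' b ≤ A a ⊓ A b) (ja : A' a ⊓ A' b ≤ A' a)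
        (jb : A' a ⊓ A' b ≤ A' b),
        ι.app _ (secRes X j (G a b) * secRes X jb (Λ₁ b)) =
          ι.app _ (secRes X ja (Λ₁ a) * L a b)) := by
  subst hι
  obtain ⟨β⟩ : Equiv (pullback t Λ) g :=
    (CechPic.mk_eq_mk_iff _ _).mp (by rw [← CechPic.pullback_mk, hΛ])
  -- affine opens of `X` around `ι (σ a)`, small for `A`, for the coboundary and for `Λ`
  have href : ∀ a : S, ∃ A' : X.Opens, IsAffineOpen A' ∧ A' ≤ A a ∧ (t ≫ ι').base (σ a) ∈ A' ∧
      (t ≫ ι') ⁻¹ᵁ A' ≤ β.W (σ a) ∧ ι' ⁻¹ᵁ A' ≤ Λ.U (t.base (σ a)) := by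
    intro a
    obtain ⟨O₁, hO₁, hO₁W⟩ := hιe.isOpen_iff.mp (β.W (σ a)).isOpen
    obtain ⟨O₂, hO₂, hO₂U⟩ := hι'e.isOpen_iff.mp (Λ.U (t.base (σ a))).isOpen
    have hxA : (t ≫ ι').base (σ a) ∈ A a := by simpa only [hπσ] using mem (σ a)
    have hx₁ : (t ≫ ι').base (σ a) ∈ O₁ := by
      rw [← Set.mem_preimage, hO₁W]
      exact β.mem (σ a)
    have hx₂ : ι'.base (t.base (σ a)) ∈ O₂ := by
      rw [← Set.mem_preimage, hO₂U]
      exact Λ.mem (t.base (σ a))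
    have hx : (t ≫ ι').base (σ a) ∈ (A a ⊓ ⟨O₁, hO₁⟩ ⊓ ⟨O₂, hO₂⟩ : X.Opens) := ⟨⟨hxA, hx₁⟩, hx₂⟩
    obtain ⟨A', hA', hxA', hle⟩ := Opens.isBasis_iff_nbhd.mp X.isBasis_affineOpens hx
    refine ⟨A', hA', hle.trans (inf_le_left.trans inf_le_left), hxA', fun y hy => ?_,
      fun y hy => ?_⟩
    · have h : y ∈ (t ≫ ι').base ⁻¹' O₁ := (hle hy).1.2
      rwa [hO₁W] at h
    · have h : y ∈ ι'.base ⁻¹' O₂ := (hle hy).2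
      rwa [hO₂U] at h
  choose A' hA' hle hmemσ hW hΛU using href
  have hWa : ∀ a b, (t ≫ ι') ⁻¹ᵁ (A' a ⊓ A' b) ≤ β.W (σ a) := fun a b =>
    (Scheme.Hom.preimage_mono _ inf_le_left).trans (hW a)
  have hWb : ∀ a b, (t ≫ ι') ⁻¹ᵁ (A' a ⊓ A' b) ≤ β.W (σ b) := fun a b =>
    (Scheme.Hom.preimage_mono _ inf_le_right).trans (hW b)
  have hΛa : ∀ a b, ι' ⁻¹ᵁ (A' a ⊓ A' b) ≤ Λ.U (t.base (σ a)) := fun a b =>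
    (ι'.preimage_mono inf_le_left).trans (hΛU a)
  have hΛb : ∀ a b, ι' ⁻¹ᵁ (A' a ⊓ A' b) ≤ Λ.U (t.base (σ b)) := fun a b =>
    (ι'.preimage_mono inf_le_right).trans (hΛU b)
  -- lifts to `X` of the coboundary, of its inverse, and of the transition functions of `Λ`
  choose Λ₁ hΛ₁ using fun a => hsurj (A' a) (hA' a) (β.lam (σ a) _ (hW a))
  choose Λ₂ hΛ₂ using fun a => hsurj (A' a) (hA' a) (β.inv (σ a) _ (hW a))
  choose L hL using fun a b => hsurj' (A' a ⊓ A' b) (hinf _ _ (hA' a) (hA' b))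
    (Λ.g (t.base (σ a)) (t.base (σ b)) _ (hΛa a b) (hΛb a b))
  refine ⟨A', hA', hle, hmemσ, L, Λ₁, Λ₂, fun a b c i₁ i₂ i₃ => ?_, fun a => ?_,
    fun a b j ja jb => ?_⟩
  · rw [map_mul, app_secRes ι' i₁, app_secRes ι' i₂, app_secRes ι' i₃, hL, hL, hL, Λ.map_g,
      Λ.map_g, Λ.map_g]
    exact Λ.g_mul _ _ _ _ _ _ _
  · rw [map_mul, hΛ₁, hΛ₂, β.lam_mul_inv]
  · have rel := β.rel (σ a) (σ b) _ (hWa a b) (hWb a b)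
    rw [hg, pullback_g, appLE_congr_index (t ≫ ι') A G (hπσ a) (hπσ b) _
        (Scheme.Hom.preimage_mono _ (inf_le_inf (hle a) (hle b))),
      ← appLE_secRes (t ≫ ι') j le_rfl, Scheme.Hom.appLE_eq_app,
      ← appLE_secRes t (le_inf (hΛa a b) (hΛb a b) : ι' ⁻¹ᵁ (A' a ⊓ A' b) ≤ _)
        (le_rfl : (t ≫ ι') ⁻¹ᵁ (A' a ⊓ A' b) ≤ t ⁻¹ᵁ ι' ⁻¹ᵁ (A' a ⊓ A' b)),
      Λ.map_g, ← hL a b, appLE_app] at rel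
    rw [map_mul, map_mul, app_secRes (t ≫ ι') jb (Λ₁ b), app_secRes (t ≫ ι') ja (Λ₁ a), hΛ₁,
      hΛ₁, β.map_lam, β.map_lam]
    exact rel

/-- **Obstruction, direction ⇒.** In the situation of `exists_presented_coboundary`, assume moreover
that `ι^♯`, `ι'^♯` have kernels `pⁿ Γ(X, U)`, resp. `pⁿ⁺¹ Γ(X, U)` on affine opens `U`, that
`n ≥ 1`, and that the `G_{ab}` are invertible modulo `p` (`G_{ab} H_{ab} = 1 + p e`). If `[g]`
is the pull-back of a class on `Y'`, then on an affine refinement `A'` there are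
`v_{ab} ∈ Γ(X, A'_a ⊓ A'_b)` with
`G_{ab} G_{bc} ≡ G_{ac}(1 + pⁿ(v_{bc} - v_{ac} + v_{ab})) (mod pⁿ⁺¹)` over `A'_a ⊓ A'_b ⊓ A'_c`
(Hartshorne III Ex. 4.6: the obstruction in `H²` of a liftable class is a coboundary). [folklore] -/
theorem exists_coboundary_of_lifts (t : Y ⟶ Y') (ι' : Y' ⟶ X) {ι : Y ⟶ X} (hι : ι = t ≫ ι')
    (hιe : Topology.IsInducing ι.base) (hι'e : Topology.IsInducing ι'.base)
    (hinf : ∀ U V : X.Opens, IsAffineOpen U → IsAffineOpen V → IsAffineOpen (U ⊓ V))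
    (p n : ℕ) (hn : 1 ≤ n)
    (hsurj : ∀ U : X.Opens, IsAffineOpen U → Function.Surjective (ι.app U))
    (hker : ∀ U : X.Opens, IsAffineOpen U → ∀ r : Γ(X, U), ι.app U r = 0 →
      ∃ c : Γ(X, U), r = (p : Γ(X, U)) ^ n * c)
    (hsurj' : ∀ U : X.Opens, IsAffineOpen U → Function.Surjective (ι'.app U))
    (hker' : ∀ U : X.Opens, IsAffineOpen U → ∀ r : Γ(X, U), ι'.app U r = 0 →
      ∃ c : Γ(X, U), r = (p : Γ(X, U)) ^ (n + 1) * c)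
    (π : Y → S) (σ : S → Y) (hπσ : ∀ a, π (σ a) = a)
    (A : S → X.Opens) (G H : ∀ a b : S, Γ(X, A a ⊓ A b)) (mem : ∀ y, ι.base y ∈ A (π y))
    (hGH : ∀ a b, ∃ e : Γ(X, A a ⊓ A b), G a b * H a b = 1 + (p : Γ(X, A a ⊓ A b)) * e)
    {g : UnitCocycle Y} (hU : ∀ y, g.U y = ι ⁻¹ᵁ A (π y))
    (hg : ∀ (y y' : Y) (V : Y.Opens) (hy : V ≤ g.U y) (hy' : V ≤ g.U y'),
      g.g y y' V hy hy' = ι.appLE (A (π y) ⊓ A (π y')) V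
        (le_preimage_inf ι (hy.trans_eq (hU y)) (hy'.trans_eq (hU y'))) (G (π y) (π y')))
    (hlift : ∃ c' : CechPic Y', CechPic.pullback t c' = CechPic.mk g) :
    ∃ (A' : S → X.Opens) (_ : ∀ a, IsAffineOpen (A' a)) (_ : ∀ a, A' a ≤ A a)
      (_ : ∀ a, ι.base (σ a) ∈ A' a) (v : ∀ a b : S, Γ(X, A' a ⊓ A' b)),
      ∀ (a b c : S) (i₁ : A' a ⊓ A' b ⊓ A' c ≤ A a ⊓ A b) (i₂ : A' a ⊓ A' b ⊓ A' c ≤ A b ⊓ A c)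
        (i₃ : A' a ⊓ A' b ⊓ A' c ≤ A a ⊓ A c) (j₁ : A' a ⊓ A' b ⊓ A' c ≤ A' a ⊓ A' b)
        (j₂ : A' a ⊓ A' b ⊓ A' c ≤ A' b ⊓ A' c) (j₃ : A' a ⊓ A' b ⊓ A' c ≤ A' a ⊓ A' c),
        ∃ z, secRes X i₁ (G a b) * secRes X i₂ (G b c) =
          secRes X i₃ (G a c) * (1 + (p : Γ(X, A' a ⊓ A' b ⊓ A' c)) ^ n *
            (secRes X j₂ (v b c) - secRes X j₃ (v a c) + secRes X j₁ (v a b))) +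
          (p : Γ(X, A' a ⊓ A' b ⊓ A' c)) ^ (n + 1) * z := by
  obtain ⟨c', hc'⟩ := hlift
  obtain ⟨Λ, rfl⟩ := CechPic.mk_surjective c'
  obtain ⟨A', hA', hle, hmemσ, L, Λ₁, Λ₂, h1, h2, h3⟩ :=
    exists_presented_coboundary t ι' hι hιe hι'e hsurj hsurj' hinf π σ hπσ A G mem hU hg hc'
  -- the defects `r_{ab}` of the coboundary relation and `w_a` of the inverses, modulo `pⁿ`
  have h3' : ∀ a b, ∃ r : Γ(X, A' a ⊓ A' b),
      secRes X (inf_le_inf (hle a) (hle b)) (G a b) * secRes X inf_le_right (Λ₁ b) =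
        secRes X inf_le_left (Λ₁ a) * L a b + (p : Γ(X, A' a ⊓ A' b)) ^ n * r := by
    intro a b
    obtain ⟨r, hr⟩ := hker _ (hinf _ _ (hA' a) (hA' b))
      (secRes X (inf_le_inf (hle a) (hle b)) (G a b) * secRes X inf_le_right (Λ₁ b) -
        secRes X inf_le_left (Λ₁ a) * L a b)
      (by rw [map_sub, sub_eq_zero]; exact h3 a b _ _ _)
    exact ⟨r, by linear_combination hr⟩
  choose r hr using h3'
  have h2' : ∀ a, ∃ w : Γ(X, A' a), Λ₁ a * Λ₂ a = 1 + (p : Γ(X, A' a)) ^ n * w := by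
    intro a
    obtain ⟨w, hw⟩ := hker _ (hA' a) (Λ₁ a * Λ₂ a - 1)
      (by rw [map_sub, map_one, sub_eq_zero, h2])
    exact ⟨w, by linear_combination hw⟩
  choose w hw using h2'
  refine ⟨A', hA', hle, hmemσ, fun a b =>
    secRes X (inf_le_inf (hle a) (hle b)) (H a b) * r a b * secRes X inf_le_right (Λ₂ b),
    fun a b c i₁ i₂ i₃ j₁ j₂ j₃ => ?_⟩
  obtain ⟨z, hz⟩ := hker' _ (hinf _ _ (hinf _ _ (hA' a) (hA' b)) (hA' c))
    (secRes X j₁ (L a b) * secRes X j₂ (L b c) - secRes X j₃ (L a c))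
    (by rw [map_sub, sub_eq_zero]; exact h1 a b c j₁ j₂ j₃)
  obtain ⟨eab, heab⟩ := hGH a b
  obtain ⟨ebc, hebc⟩ := hGH b c
  obtain ⟨eac, heac⟩ := hGH a c
  -- everything restricted to `A'_a ⊓ A'_b ⊓ A'_c`
  have e3ab := congrArg (secRes X j₁) (hr a b)
  have e3bc := congrArg (secRes X j₂) (hr b c)
  have e3ac := congrArg (secRes X j₃) (hr a c)
  have e2b := congrArg (secRes X (j₁.trans inf_le_right)) (hw b)
  have e2c := congrArg (secRes X (j₂.trans inf_le_right)) (hw c)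
  have eUab := congrArg (secRes X i₁) heab
  have eUbc := congrArg (secRes X i₂) hebc
  have eUac := congrArg (secRes X i₃) heac
  simp only [map_mul, map_add, map_pow, map_natCast, secRes_secRes] at e3ab e3bc e3ac
  simp only [map_mul, map_add, map_one, map_pow, map_natCast] at e2b e2c eUab eUbc eUac
  simp only [map_mul, secRes_secRes]
  -- and read modulo `pⁿ⁺¹`
  refine exists_eq_add_mul_of_mk_eq ?_
  set mk := Ideal.Quotient.mk (Ideal.span {(p : Γ(X, A' a ⊓ A' b ⊓ A' c)) ^ (n + 1)}) with hmk
  have h0 : mk (p : _) ^ (n + 1) = 0 := by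
    rw [← map_pow, hmk, Ideal.Quotient.eq_zero_iff_mem]
    exact Ideal.mem_span_singleton_self _
  have hππ : mk (p : _) ^ n * mk (p : _) ^ n = 0 := by
    obtain ⟨n, rfl⟩ : ∃ n', n = n' + 1 := ⟨n - 1, by omega⟩
    linear_combination mk (p : _) ^ n * h0
  have hπϖ : mk (p : _) ^ n * mk (p : _) = 0 := by rw [← pow_succ, h0]
  have q3ab := congrArg mk e3ab
  have q3bc := congrArg mk e3bc
  have q3ac := congrArg mk e3ac
  have q1 := congrArg mk hz
  have q2b := congrArg mk e2b
  have q2c := congrArg mk e2c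
  have qUab := congrArg mk eUab
  have qUbc := congrArg mk eUbc
  have qUac := congrArg mk eUac
  simp only [map_mul, map_add, map_pow] at q3ab q3bc q3ac
  simp only [map_mul, map_sub, map_pow, h0, zero_mul, sub_eq_zero] at q1
  simp only [map_mul, map_add, map_one, map_pow] at q2b q2c qUab qUbc qUac
  simp only [map_mul, map_add, map_sub, map_one, map_pow]
  exact mul_mul_eq_of_coboundary_rel hππ hπϖ q3ab q3bc q3ac q1 q2b q2c qUab qUbc qUac

/-- **Obstruction, direction ⇐.** Let `ι = t ≫ ι'`, `pⁿ = 0` on `Y` and `pⁿ⁺¹ = 0` on `Y'`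
(`n ≥ 1`), and let `g` on `Y` be presented along `ι` by `(A, G)` with the `G_{ab}` invertible
modulo `p`. If on a refinement `A'` (containing `ι(Y)`, `ι'(Y')` in the indexed sense) there are
`v_{ab}` with `G_{ab} G_{bc} ≡ G_{ac}(1 + pⁿ(v_{bc} - v_{ac} + v_{ab})) (mod pⁿ⁺¹)`, then `[g]` is
the pull-back along `t` of a class on `Y'` — namely of the class presented along `ι'` by
`G_{ab}(1 - pⁿ v_{ab})` (Hartshorne III Ex. 4.6). [folklore] -/
theorem exists_lift_of_coboundary (t : Y ⟶ Y') (ι' : Y' ⟶ X) {ι : Y ⟶ X} (hι : ι = t ≫ ι')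
    (p n : ℕ) (hn : 1 ≤ n) (hzero : ∀ V : Y.Opens, (p : Γ(Y, V)) ^ n = 0)
    (hzero' : ∀ V : Y'.Opens, (p : Γ(Y', V)) ^ (n + 1) = 0)
    (π : Y → S) (π' : Y' → S) (hπ : ∀ y, π' (t.base y) = π y)
    (A : S → X.Opens) (G H : ∀ a b : S, Γ(X, A a ⊓ A b))
    (hGH : ∀ a b, ∃ e : Γ(X, A a ⊓ A b), G a b * H a b = 1 + (p : Γ(X, A a ⊓ A b)) * e)
    {g : UnitCocycle Y} (hU : ∀ y, g.U y = ι ⁻¹ᵁ A (π y))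
    (hg : ∀ (y y' : Y) (V : Y.Opens) (hy : V ≤ g.U y) (hy' : V ≤ g.U y'),
      g.g y y' V hy hy' = ι.appLE (A (π y) ⊓ A (π y')) V
        (le_preimage_inf ι (hy.trans_eq (hU y)) (hy'.trans_eq (hU y'))) (G (π y) (π y')))
    (A' : S → X.Opens) (hle : ∀ a, A' a ≤ A a) (memA : ∀ y, ι.base y ∈ A' (π y))
    (memA' : ∀ y', ι'.base y' ∈ A' (π' y')) (v : ∀ a b : S, Γ(X, A' a ⊓ A' b))
    (hcob : ∀ (a b c : S) (i₁ : A' a ⊓ A' b ⊓ A' c ≤ A a ⊓ A b)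
      (i₂ : A' a ⊓ A' b ⊓ A' c ≤ A b ⊓ A c) (i₃ : A' a ⊓ A' b ⊓ A' c ≤ A a ⊓ A c)
      (j₁ : A' a ⊓ A' b ⊓ A' c ≤ A' a ⊓ A' b) (j₂ : A' a ⊓ A' b ⊓ A' c ≤ A' b ⊓ A' c)
      (j₃ : A' a ⊓ A' b ⊓ A' c ≤ A' a ⊓ A' c),
      ∃ z, secRes X i₁ (G a b) * secRes X i₂ (G b c) =
        secRes X i₃ (G a c) * (1 + (p : Γ(X, A' a ⊓ A' b ⊓ A' c)) ^ n *
          (secRes X j₂ (v b c) - secRes X j₃ (v a c) + secRes X j₁ (v a b))) +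
        (p : Γ(X, A' a ⊓ A' b ⊓ A' c)) ^ (n + 1) * z) :
    ∃ c' : CechPic Y', CechPic.pullback t c' = CechPic.mk g := by
  obtain ⟨n, rfl⟩ : ∃ n', n = n' + 1 := ⟨n - 1, by omega⟩
  -- the corrected datum on `A'`
  set G' : ∀ a b : S, Γ(X, A' a ⊓ A' b) := fun a b =>
    secRes X (inf_le_inf (hle a) (hle b)) (G a b) * (1 - (p : Γ(X, A' a ⊓ A' b)) ^ (n + 1) * v a b)
    with hG'
  -- satisfies the cocycle identity modulo `pⁿ⁺¹`
  have hmul' : ∀ (a b c : S) (j₁ : A' a ⊓ A' b ⊓ A' c ≤ A' a ⊓ A' b)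
      (j₂ : A' a ⊓ A' b ⊓ A' c ≤ A' b ⊓ A' c) (j₃ : A' a ⊓ A' b ⊓ A' c ≤ A' a ⊓ A' c),
      ∃ z, secRes X j₁ (G' a b) * secRes X j₂ (G' b c) =
        secRes X j₃ (G' a c) + (p : Γ(X, A' a ⊓ A' b ⊓ A' c)) ^ (n + 1 + 1) * z := by
    intro a b c j₁ j₂ j₃
    obtain ⟨z, hz⟩ := hcob a b c (j₁.trans (inf_le_inf (hle a) (hle b)))
      (j₂.trans (inf_le_inf (hle b) (hle c))) (j₃.trans (inf_le_inf (hle a) (hle c))) j₁ j₂ j₃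
    simp only [hG', map_mul, map_sub, map_one, map_pow, map_natCast, secRes_secRes]
    refine exists_eq_add_mul_of_mk_eq ?_
    set mk := Ideal.Quotient.mk (Ideal.span {(p : Γ(X, A' a ⊓ A' b ⊓ A' c)) ^ (n + 1 + 1)})
      with hmk
    have h0 : mk (p : _) ^ (n + 1 + 1) = 0 := by
      rw [← map_pow, hmk, Ideal.Quotient.eq_zero_iff_mem]
      exact Ideal.mem_span_singleton_self _
    have hππ : mk (p : _) ^ (n + 1) * mk (p : _) ^ (n + 1) = 0 := by
      linear_combination mk (p : _) ^ n * h0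
    have hz' := congrArg mk hz
    simp only [map_mul, map_add, map_sub, map_one, map_pow, h0, zero_mul, add_zero] at hz' ⊢
    exact corrected_mul_eq hππ hz'
  have hmulι' : ∀ (a b c : S) (j₁ : A' a ⊓ A' b ⊓ A' c ≤ A' a ⊓ A' b)
      (j₂ : A' a ⊓ A' b ⊓ A' c ≤ A' b ⊓ A' c) (j₃ : A' a ⊓ A' b ⊓ A' c ≤ A' a ⊓ A' c),
      ι'.app _ (secRes X j₁ (G' a b) * secRes X j₂ (G' b c)) = ι'.app _ (secRes X j₃ (G' a c)) := by
    intro a b c j₁ j₂ j₃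
    obtain ⟨z, hz⟩ := hmul' a b c j₁ j₂ j₃
    have h0 : ι'.app _ ((p : Γ(X, A' a ⊓ A' b ⊓ A' c)) ^ (n + 1 + 1) * z) = 0 := by
      rw [map_mul, map_pow, map_natCast, hzero', zero_mul]
    rw [hz, map_add, h0, add_zero]
  have hmulι : ∀ (a b c : S) (j₁ : A' a ⊓ A' b ⊓ A' c ≤ A' a ⊓ A' b)
      (j₂ : A' a ⊓ A' b ⊓ A' c ≤ A' b ⊓ A' c) (j₃ : A' a ⊓ A' b ⊓ A' c ≤ A' a ⊓ A' c),
      ι.app _ (secRes X j₁ (G' a b) * secRes X j₂ (G' b c)) = ι.app _ (secRes X j₃ (G' a c)) := by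
    intro a b c j₁ j₂ j₃
    obtain ⟨z, hz⟩ := hmul' a b c j₁ j₂ j₃
    have h0 : ι.app _ ((p : Γ(X, A' a ⊓ A' b ⊓ A' c)) ^ (n + 1 + 1) * z) = 0 := by
      rw [map_mul, map_pow, map_natCast, pow_succ, hzero, zero_mul, zero_mul]
    rw [hz, map_add, h0, add_zero]
  -- and consists of units modulo `p`
  have hGH' : ∀ a, ∃ e : Γ(X, A' a ⊓ A' a),
      G' a a * secRes X (inf_le_inf (hle a) (hle a)) (H a a) = 1 + (p : Γ(X, A' a ⊓ A' a)) * e := by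
    intro a
    obtain ⟨e, he⟩ := hGH a a
    have he' := congrArg (secRes X (inf_le_inf (hle a) (hle a) : A' a ⊓ A' a ≤ _)) he
    simp only [map_mul, map_add, map_one, map_natCast] at he'
    exact ⟨secRes X (inf_le_inf (hle a) (hle a)) e - (p : Γ(X, A' a ⊓ A' a)) ^ n * v a a *
      (1 + (p : Γ(X, A' a ⊓ A' a)) * secRes X (inf_le_inf (hle a) (hle a)) e),
      by rw [hG']; linear_combination (1 - (p : Γ(X, A' a ⊓ A' a)) ^ (n + 1) * v a a) * he'⟩
  have hunit' : ∀ a, IsUnit (ι'.app _ (G' a a)) := fun a => by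
    obtain ⟨e, he⟩ := hGH' a
    exact isUnit_app_of_mul_eq ι' ⟨n + 1 + 1, hzero' _⟩ he
  have hunit : ∀ a, IsUnit (ι.app _ (G' a a)) := fun a => by
    obtain ⟨e, he⟩ := hGH' a
    exact isUnit_app_of_mul_eq ι ⟨n + 1, hzero _⟩ he
  -- hence presents a class on `Y'` lifting `[g]`
  obtain ⟨g₁, hU₁, hg₁⟩ := exists_presented ι' π' A' G' memA' hmulι' hunit'
  obtain ⟨g₀, hU₀, hg₀⟩ := exists_presented ι π A' G' memA hmulι hunit
  refine ⟨CechPic.mk g₁, ?_⟩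
  rw [CechPic.pullback_mk_presented t ι' hι π' hπ memA hU₀ hg₀ hU₁ hg₁]
  refine (CechPic.mk_eq_mk_of_presented_congr hU hg memA hle hU₀ hg₀ fun a b j => ?_).symm
  rw [hG', map_mul, map_sub, map_one, map_mul, map_pow, map_natCast, hzero, zero_mul, sub_zero,
    mul_one]

end UnitCocycle

end Literature.AlgebraicGeometry.Modules

end
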